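import Mathlib.Analysis.SpecialFunctions.Log.Basic
import Mathlib.Analysis.SpecialFunctions.Exp
import Literature.Barriers.MatrixMultiplication.UniversalMethodBarrierCwCount
import Literature.Barriers.MatrixMultiplication.RectangularBarrierSliceDecomp
import HarnessLib

/-!
# Weighted covering of the powers of `CW_q` by three families of slices

Topic `Literature/Barriers/MatrixMultiplication`; third file of the PROOF of the numerical table
`CLLZ2025_omegaTwo_barrier_CW` (Christandl–Le Gall–Lysikov–Zuiddam 2025, §4.4 Table 1) of
`RectangularBarrier.lean`. In the printed proof this step is the upper bound
`log₂ ζ^θ(CW_q) ≤ max_P Σᵢ θᵢ H(Pᵢ)` over the symmetrised distributions `P` on `supp(CW_q)` (CLLZ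
§4.3–4.4, the standard bases being one choice in Strassen's minimum); here, for the elementary
tri-budget slice-rank argument of this series, it becomes a *covering* statement about the support
of `CW_q^{⊗M}`, PROVED by the partition method of the tree's `sliceRank_cwPow_le`
(`UniversalMethodBarrierCwCount.lean`: Alman 2021 Thm. 3.4, the weight-counting bound
`card_wordType_le` — Gibbs' inequality built in by the free choice of the weights — and
`card_typeCount_le`), with two changes: the three directions get separate thresholds and budgets,
and the weights `π⁽ⁱ⁾` may differ per direction.

## Content

* `exists_hasSliceDecomp_cwPow_of_thresholds` — if every support triple `(A,B,C)` of `CW_q^{⊗M}`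
  has `typeCount A ≤ t₀ ∨ typeCount B ≤ t₁ ∨ typeCount C ≤ t₂`, then `CW_q^{⊗M}` has an
  `(r₀,r₁,r₂)`-slice decomposition with `rᵢ ≤ 1 + (M+1)³ tᵢ` (cover the support: direction `i`
  takes the triples whose `i`-th word has type count `≤ tᵢ`).
* `sum_mul_log_weightBound_le` — **the weighted entropy bound in dual form**: for `θ ∈ ℝ³₊`,
  per-direction positive sub-probability vectors `π⁽ⁱ⁾` on the three classes `X₀ = {x₀}`,
  `X₁ = {x₁..x_q}`, `X₂ = {x_{q+1}}`, and `Bmax` at least the *cost*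
  `Σᵢ θᵢ log(|X_{cᵢ}| / π⁽ⁱ⁾_{cᵢ})` of every class triple `(c₀,c₁,c₂)` of a term of `CW_q` (six
  triples: `011, 101, 110, 200, 020, 002`), one has for every support triple of `CW_q^{⊗M}`
  `Σᵢ θᵢ log Wᵢ ≤ M · Bmax`, `Wᵢ = Πₖ (|Xₖ|/π⁽ⁱ⁾ₖ)^{ηᵢₖ}` the weight bound of the `i`-th class type.
* `exists_hasSliceDecomp_cwPow` — **the covering**: with `Σ θᵢ = 1` and positive "format sizes"
  `s₀, s₁, s₂`, `CW_q^{⊗M}` has an `(r₀,r₁,r₂)`-slice decomposition with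
  `rᵢ ≤ 1 + (M+1)³ sᵢ · exp(M·Bmax − Σᵢ θᵢ log sᵢ)`.

## References

* M. Christandl, F. Le Gall, V. Lysikov, J. Zuiddam, comput. complexity 34 (2025) =
  arXiv:2003.03019, §4.3–§4.4 (the symmetrised entropy optimisation over `supp(CW_q)`; its dual
  form is the hypothesis on `Bmax`). [ChristandlLeGallLysikovZuiddam2025]
* J. Alman, Theory of Computing 17 (2021), Thm. 3.4 and §4.1 (partition of the support of
  `CW_q^{⊗M}` by class types), as formalised in `UniversalMethodBarrierCwCount.lean`. [Alman2021]
-/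

noncomputable section

open scoped BigOperators

namespace Literature.Barriers.MatrixMultiplication

open Literature.Computability.AlgebraicComplexity Literature.Combinatorics.Additive Finset

universe u

variable {K : Type u} [Field K]

/-! ## The cover with three thresholds -/

/-- **Covering `CW_q^{⊗M}` with separate thresholds**: if every support triple `(A,B,C)` has a
coordinate whose type count is below the threshold of its direction, then the three families of
words of small type count give an `(r₀,r₁,r₂)`-slice decomposition with `rᵢ ≤ 1 + (M+1)³ tᵢ` (the
`1 +` accounts for a dummy slice). The construction of `sliceRank_cwPow_le`, budgets kept apart.
[cite: Alman2021, Thm. 3.4 (proof)] -/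
theorem exists_hasSliceDecomp_cwPow_of_thresholds (q M : ℕ) (t : Fin 3 → ℝ) (ht : ∀ i, 0 ≤ t i)
    (hgood : ∀ A B C : Fin M → Fin (q + 2), kroneckerPow (bigCwTensor K q) M A B C ≠ 0 →
      (typeCount q A : ℝ) ≤ t 0 ∨ (typeCount q B : ℝ) ≤ t 1 ∨ (typeCount q C : ℝ) ≤ t 2) :
    ∃ r : Fin 3 → ℕ, HasSliceDecomp (kroneckerPow (bigCwTensor K q) M) (r 0) (r 1) (r 2) ∧
      ∀ i, (r i : ℝ) ≤ 1 + ((M : ℝ) + 1) ^ 3 * t i := by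
  classical
  set T := kroneckerPow (bigCwTensor K q) M with hT
  -- the covering families, one per direction
  set S : Fin 3 → Type := fun i => Option {A : Fin M → Fin (q + 2) // (typeCount q A : ℝ) ≤ t i} with hS
  set Ω := {ω : (Fin M → Fin (q + 2)) × (Fin M → Fin (q + 2)) × (Fin M → Fin (q + 2)) //
    T ω.1 ω.2.1 ω.2.2 ≠ 0} with hΩ
  set πo : (i : Fin 3) → (Fin M → Fin (q + 2)) → S i := fun i A =>
    if h : (typeCount q A : ℝ) ≤ t i then some ⟨A, h⟩ else none with hπo
  set φ : (i : Fin 3) → S i → (Fin M → Fin (q + 2)) → K := fun i s =>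
    Option.elim s (fun _ => 0) (fun p x => if x = p.1 then 1 else 0) with hφ
  have hφπ : ∀ i A, (typeCount q A : ℝ) ≤ t i → φ i (πo i A) = fun x => if x = A then 1 else 0 := by
    intro i A hA
    simp only [hφ, hπo, dif_pos hA, Option.elim_some]
  have hcover : HasSliceDecomp T (Fintype.card (S 0)) (Fintype.card (S 1)) (Fintype.card (S 2)) := by
    refine hasSliceDecomp_of_cover (Ω := Ω) T (fun ω x => if x = ω.1.1 then 1 else 0)
      (fun ω y => if y = ω.1.2.1 then 1 else 0) (fun ω z => if z = ω.1.2.2 then 1 else 0) ?_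
      (fun ω => if (typeCount q ω.1.1 : ℝ) ≤ t 0 then 0
        else if (typeCount q ω.1.2.1 : ℝ) ≤ t 1 then 1 else 2)
      (fun ω => πo 0 ω.1.1) (φ 0) ?_ (fun ω => πo 1 ω.1.2.1) (φ 1) ?_ (fun ω => πo 2 ω.1.2.2) (φ 2) ?_
    · -- `T = Σ_ω e_A ⊗ e_B ⊗ e_C`
      intro x y z
      by_cases hxyz : T x y z = 0
      · rw [hxyz]
        refine (Finset.sum_eq_zero fun ω _ => ?_).symm
        have hne : (ω : _).1 ≠ (x, y, z) := fun e => ω.2 (by rw [e]; exact hxyz)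
        by_cases h1 : x = ω.1.1
        · by_cases h2 : y = ω.1.2.1
          · have h3 : z ≠ ω.1.2.2 := fun h3 => hne (by ext <;> simp [h1, h2, h3])
            simp [h3]
          · simp [h2]
        · simp [h1]
      · have hone : T x y z = 1 := cwPow_eq_one_of_ne_zero q M hxyz
        rw [Finset.sum_eq_single ⟨(x, y, z), hxyz⟩]
        · simp [hone]
        · intro ω _ hω
          have hne : (ω : _).1 ≠ (x, y, z) := fun e => hω (Subtype.ext e)
          by_cases h1 : x = ω.1.1
          · by_cases h2 : y = ω.1.2.1
            · have h3 : z ≠ ω.1.2.2 := fun h3 => hne (by ext <;> simp [h1, h2, h3])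
              simp [h3]
            · simp [h2]
          · simp [h1]
        · simp
    · intro ω hω
      have hA : (typeCount q ω.1.1 : ℝ) ≤ t 0 := by
        by_contra hA
        rw [if_neg hA] at hω
        split_ifs at hω <;> exact absurd hω (by decide)
      exact (hφπ 0 _ hA).symm
    · intro ω hω
      have hB' : (typeCount q ω.1.2.1 : ℝ) ≤ t 1 := by
        by_cases hA : (typeCount q ω.1.1 : ℝ) ≤ t 0
        · rw [if_pos hA] at hω; exact absurd hω (by decide)
        · by_contra hB'
          rw [if_neg hA, if_neg hB'] at hω
          exact absurd hω (by decide)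
      exact (hφπ 1 _ hB').symm
    · intro ω hω
      have hC : (typeCount q ω.1.2.2 : ℝ) ≤ t 2 := by
        by_cases hA : (typeCount q ω.1.1 : ℝ) ≤ t 0
        · rw [if_pos hA] at hω; exact absurd hω (by decide)
        · by_cases hB' : (typeCount q ω.1.2.1 : ℝ) ≤ t 1
          · rw [if_neg hA, if_pos hB'] at hω; exact absurd hω (by decide)
          · rcases hgood _ _ _ ω.2 with h | h | h
            · exact absurd h hA
            · exact absurd h hB'
            · exact h
      exact (hφπ 2 _ hC).symm
  -- count
  have hcard : ∀ i, (Fintype.card (S i) : ℝ) ≤ 1 + ((M : ℝ) + 1) ^ 3 * t i := by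
    intro i
    show (Fintype.card (Option {A : Fin M → Fin (q + 2) // (typeCount q A : ℝ) ≤ t i}) : ℝ) ≤ _
    rw [Fintype.card_option, Fintype.card_subtype]
    push_cast
    linarith [card_typeCount_le q M (ht i)]
  exact ⟨fun i => Fintype.card (S i), hcover, hcard⟩

/-! ## The weighted entropy bound in dual (weight-counting) form -/

/-- The cost of a class triple `(c₀,c₁,c₂)` for weights `θ` and per-direction class weights `π⁽ⁱ⁾`:
`Σᵢ θᵢ log(|X_{cᵢ}| / π⁽ⁱ⁾_{cᵢ})` (`|X₀| = |X₂| = 1`, `|X₁| = q`). [cite: ChristandlLeGallLysikovZuiddam2025, §4.4] -/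
def classTripleCost (q : ℕ) (θ : Fin 3 → ℝ) (π : Fin 3 → Fin 3 → ℝ) (c : Fin 3 → Fin 3) : ℝ :=
  ∑ i, θ i * Real.log ((classSize (cwClass q) (c i) : ℝ) / π i (c i))

/-- The weight bound `Wᵢ(A) = Πₖ (|Xₖ| / π⁽ⁱ⁾ₖ)^{type(A)ₖ}` of a word in direction `i`.
[cite: Alman2021, Thm. 3.4 (proof)] -/
def weightBound (q : ℕ) (π : Fin 3 → Fin 3 → ℝ) (i : Fin 3) {M : ℕ} (A : Fin M → Fin (q + 2)) : ℝ :=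
  ∏ k, ((classSize (cwClass q) k : ℝ) / π i k) ^ wordType (cwClass q) A k

/-- `typeCount A ≤ Wᵢ(A)` for positive sub-probability weights (the tree's `card_wordType_le`).
[cite: Alman2021, Thm. 3.4 (proof)] -/
theorem typeCount_le_weightBound (q : ℕ) (π : Fin 3 → Fin 3 → ℝ) (i : Fin 3)
    (hπ0 : ∀ k, 0 < π i k) (hπ1 : ∑ k, π i k ≤ 1) {M : ℕ} (A : Fin M → Fin (q + 2)) :
    (typeCount q A : ℝ) ≤ weightBound q π i A :=
  card_wordType_le (cwClass q) (π i) (fun k => (hπ0 k).le) hπ1 (wordType (cwClass q) A)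
    (fun k _ => hπ0 k) (m := M)

/-- `log Wᵢ(A) = Σ_ℓ log(|X_{cl A_ℓ}| / π⁽ⁱ⁾_{cl A_ℓ})` (positional form of the weight bound; `q ≥ 1`
so that all classes are nonempty). [folklore] -/
theorem log_weightBound (q : ℕ) (hq : 0 < q) (π : Fin 3 → Fin 3 → ℝ) (i : Fin 3)
    (hπ0 : ∀ k, 0 < π i k) {M : ℕ} (A : Fin M → Fin (q + 2)) :
    Real.log (weightBound q π i A) =
      ∑ ℓ, Real.log ((classSize (cwClass q) (cwClass q (A ℓ)) : ℝ) / π i (cwClass q (A ℓ))) := by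
  obtain ⟨c0, c1, c2⟩ := classSize_cwClass q
  have hcs : ∀ k, (0 : ℝ) < (classSize (cwClass q) k : ℝ) := by
    intro k
    fin_cases k
    · simp [c0]
    · simp only [Fin.mk_one, c1]; exact_mod_cast hq
    · simp [c2]
  have hx : ∀ k, (0 : ℝ) < (classSize (cwClass q) k : ℝ) / π i k := fun k => div_pos (hcs k) (hπ0 k)
  unfold weightBound
  rw [Real.log_prod fun k _ => (pow_pos (hx k) _).ne']
  simp_rw [Real.log_pow]
  -- `type(A)ₖ = Σ_ℓ [cl A_ℓ = k]`
  have htype : ∀ k, (wordType (cwClass q) A k : ℝ) = ∑ ℓ, if cwClass q (A ℓ) = k then (1 : ℝ) else 0 := by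
    intro k
    rw [wordType_eq_sum]
    push_cast
    rfl
  simp_rw [htype, Finset.sum_mul]
  rw [Finset.sum_comm]
  refine Finset.sum_congr rfl fun ℓ _ => ?_
  simp only [ite_mul, one_mul, zero_mul]
  rw [Finset.sum_ite_eq]
  simp

/-- **The weighted entropy bound, dual form**: if `Bmax` is at least the cost of each of the six
class triples of the terms of `CW_q`, then along every support triple `(A,B,C)` of `CW_q^{⊗M}`,
`Σᵢ θᵢ log Wᵢ ≤ M · Bmax` (sum the per-position costs). With the optimal `π⁽ⁱ⁾` (the class
marginals of the optimal symmetrised `P`), `min Bmax = max_P Σᵢ θᵢ H(Pᵢ)` is the entropy maximum of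
CLLZ §4.4 (natural logarithms here). [cite: ChristandlLeGallLysikovZuiddam2025, §4.4] -/
theorem sum_mul_log_weightBound_le (q : ℕ) (hq : 0 < q) (θ : Fin 3 → ℝ) (π : Fin 3 → Fin 3 → ℝ)
    (hπ0 : ∀ i k, 0 < π i k) (Bmax : ℝ)
    (hB : ∀ a b c : Fin (q + 2), bigCwTensor K q a b c ≠ 0 →
      classTripleCost q θ π ![cwClass q a, cwClass q b, cwClass q c] ≤ Bmax)
    {M : ℕ} {A B C : Fin M → Fin (q + 2)} (h : kroneckerPow (bigCwTensor K q) M A B C ≠ 0) :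
    θ 0 * Real.log (weightBound q π 0 A) + θ 1 * Real.log (weightBound q π 1 B) +
      θ 2 * Real.log (weightBound q π 2 C) ≤ M * Bmax := by
  rw [log_weightBound q hq π 0 (hπ0 0) A, log_weightBound q hq π 1 (hπ0 1) B,
    log_weightBound q hq π 2 (hπ0 2) C, Finset.mul_sum, Finset.mul_sum, Finset.mul_sum,
    ← Finset.sum_add_distrib, ← Finset.sum_add_distrib]
  have hsupp : ∀ ℓ, bigCwTensor K q (A ℓ) (B ℓ) (C ℓ) ≠ 0 := by
    rw [kroneckerPow_apply, Finset.prod_ne_zero_iff] at h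
    exact fun ℓ => h ℓ (Finset.mem_univ _)
  calc ∑ ℓ, (θ 0 * Real.log ((classSize (cwClass q) (cwClass q (A ℓ)) : ℝ) / π 0 (cwClass q (A ℓ))) +
        θ 1 * Real.log ((classSize (cwClass q) (cwClass q (B ℓ)) : ℝ) / π 1 (cwClass q (B ℓ))) +
        θ 2 * Real.log ((classSize (cwClass q) (cwClass q (C ℓ)) : ℝ) / π 2 (cwClass q (C ℓ))))
      ≤ ∑ _ℓ : Fin M, Bmax := by
        refine Finset.sum_le_sum fun ℓ _ => ?_
        have := hB _ _ _ (hsupp ℓ)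
        simpa [classTripleCost, Fin.sum_univ_three] using this
    _ = M * Bmax := by simp

/-! ## The covering of `CW_q^{⊗M}` adapted to weights and format sizes -/

/-- **Weighted covering of `CW_q^{⊗M}`**: for positive weights `θ` summing to `1`, positive
sub-probability class weights `π⁽ⁱ⁾`, `Bmax` dominating the six class-triple costs, and any positive
"format sizes" `s₀, s₁, s₂`, the power `CW_q^{⊗M}` has an `(r₀,r₁,r₂)`-slice decomposition with
`rᵢ ≤ 1 + (M+1)³ · sᵢ · exp(M·Bmax − Σᵢ θᵢ log sᵢ)`. (Thresholds `tᵢ = sᵢ e^λ` with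
`Σ θᵢ log tᵢ = M·Bmax`: a support triple with all three type counts above threshold would have
`Σ θᵢ log Wᵢ > M·Bmax`.) [cite: ChristandlLeGallLysikovZuiddam2025, §4.4] -/
theorem exists_hasSliceDecomp_cwPow (q M : ℕ) (hq : 0 < q) (θ : Fin 3 → ℝ) (hθ0 : ∀ i, 0 < θ i)
    (hθ1 : ∑ i, θ i = 1) (π : Fin 3 → Fin 3 → ℝ) (hπ0 : ∀ i k, 0 < π i k)
    (hπ1 : ∀ i, ∑ k, π i k ≤ 1) (Bmax : ℝ)
    (hB : ∀ a b c : Fin (q + 2), bigCwTensor K q a b c ≠ 0 →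
      classTripleCost q θ π ![cwClass q a, cwClass q b, cwClass q c] ≤ Bmax)
    (s : Fin 3 → ℝ) (hs : ∀ i, 0 < s i) :
    ∃ r : Fin 3 → ℕ, HasSliceDecomp (kroneckerPow (bigCwTensor K q) M) (r 0) (r 1) (r 2) ∧
      ∀ i, (r i : ℝ) ≤ 1 + ((M : ℝ) + 1) ^ 3 *
        (s i * Real.exp (M * Bmax - ∑ j, θ j * Real.log (s j))) := by
  set lam : ℝ := M * Bmax - ∑ j, θ j * Real.log (s j) with hlam
  set t : Fin 3 → ℝ := fun i => s i * Real.exp lam with htdef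
  have htpos : ∀ i, 0 < t i := fun i => mul_pos (hs i) (Real.exp_pos _)
  have hlogt : ∀ i, Real.log (t i) = Real.log (s i) + lam := fun i => by
    rw [htdef]; dsimp only; rw [Real.log_mul (hs i).ne' (Real.exp_pos _).ne', Real.log_exp]
  -- the threshold identity `Σ θᵢ log tᵢ = M Bmax`
  have hsumt : θ 0 * Real.log (t 0) + θ 1 * Real.log (t 1) + θ 2 * Real.log (t 2) = M * Bmax := by
    rw [hlogt, hlogt, hlogt]
    have h3 : θ 0 + θ 1 + θ 2 = 1 := by simpa [Fin.sum_univ_three] using hθ1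
    have hl : lam = M * Bmax - (θ 0 * Real.log (s 0) + θ 1 * Real.log (s 1) + θ 2 * Real.log (s 2)) := by
      rw [hlam, Fin.sum_univ_three]
    rw [hl]
    linear_combination (M * Bmax - (θ 0 * Real.log (s 0) + θ 1 * Real.log (s 1) +
      θ 2 * Real.log (s 2))) * h3
  refine exists_hasSliceDecomp_cwPow_of_thresholds q M t (fun i => (htpos i).le) ?_
  intro A B C h
  by_contra hcon
  push Not at hcon
  obtain ⟨hA, hB', hC⟩ := hcon
  have wA := typeCount_le_weightBound q π 0 (hπ0 0) (hπ1 0) A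
  have wB := typeCount_le_weightBound q π 1 (hπ0 1) (hπ1 1) B
  have wC := typeCount_le_weightBound q π 2 (hπ0 2) (hπ1 2) C
  have lA : Real.log (t 0) < Real.log (weightBound q π 0 A) := Real.log_lt_log (htpos 0) (hA.trans_le wA)
  have lB : Real.log (t 1) < Real.log (weightBound q π 1 B) := Real.log_lt_log (htpos 1) (hB'.trans_le wB)
  have lC : Real.log (t 2) < Real.log (weightBound q π 2 C) := Real.log_lt_log (htpos 2) (hC.trans_le wC)
  have key := sum_mul_log_weightBound_le (K := K) q hq θ π hπ0 Bmax hB h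
  have m0 := mul_lt_mul_of_pos_left lA (hθ0 0)
  have m1 := mul_lt_mul_of_pos_left lB (hθ0 1)
  have m2 := mul_lt_mul_of_pos_left lC (hθ0 2)
  linarith

end Literature.Barriers.MatrixMultiplication

end
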